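import Summits.QuantumFields.BalabanUV.T4Continuum.Support.VariationalLeaves
import Summits.QuantumFields.BalabanUV.T4Continuum.Support.VariationalOneStepSymbol
import Literature.MathematicalPhysics.QuantumFieldTheory.Balaban1983to89.B5Hk163Form166

/-!
# T⁴ programme, spine node NE2 (U1a), lane P2 — LEAF L0-PLANCH of the variational route PROVED and the tier-0 assembly:
# `MinimiserRegularityL2 d C_reg ⟹ OneStepConsistency d L (3γ₀⁻⁶·(π⁴/32)·C_reg)` for EVERY block side `L ≥ 1`
# (`t4/skeletons/NE2-t4-ne2-p2.md` §2–§3; cell `pub-balaban`, row NE2 co-owner #2, lineage t4-ne2-p2 gen 9)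

HONEST FRAMING (T4-DAG p. 1): rung (B)+1 only — NOT infinite volume, NOT a mass gap, NOT Clay.  `U = 1` torus algebra (Plancherel
dictionary) over tree theorems; NOTHING printed is a hypothesis; NOT an η-rate by itself.  After this module the form-level η-rate
of Bałaban's `U = 1` effective action along the VARIATIONAL route, `0 ≤ Δ_{k+1}(B) − Δ_k(B) ≤ C₁L^{−2k}Δ_k(B)`
(`VariationalLeaves.effAction_rate_king`), depends on EXACTLY ONE open leaf: the L²-regularity of the minimiser
`VariationalLeaves.MinimiserRegularityL2` (L0-REG).  (The conclusion itself is already a tree theorem by the Fourier route —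
`B5ActionRate166` / `T4GaugeActionRate`; the value of the variational route is its background twin, skeleton §2 tier ⁺.)  HONEST
DEPENDENCY (cell, verbatim): continuum YM on T⁴ ⇐ BetaPertH ∧ nine spine estimates (0/9 proved); BetaPertH ⇐ (D1) ∧ (D4) ∧
CAP+tail; G-an2-4 gates asym, D1 and NE2/3/4.  No `sorry`.

WHAT IS PROVED ([folklore] junctions; tree inputs BY NAME: `B5Hk163Form166.form_DstarD_HkOp` ((1.65) = (1.66) for the typed
`H_k`), `B5Bounds167Lattice.d1Sq_eq_sum_hat` / `hat_fdiff` / `hat_curl` / `sum_norm_sq_dft` / `curlHat_eq_zero_of` (torus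
Plancherel), this lineage's `VariationalOneStepSymbol.w166_sub_w166_le_Delta0` (L0-ONE) and a local copy of `XInOne`):
* §1 `effAction_eq_formDk`: `Δ_k(B)` (the constrained minimum value, physical units) `= formDk n M B` (the third expression of (1.66));
  `Sphys_eq_d1Sq`: `⟨∂A, ∂A⟩_η = n^{2−d}·d1Sq A`; `oneStepAction_eq`: `S¹(A) = n^{2−d}·formDk L (fine n M) A`.
* §2 `w166_one_eq_one`: at block side `1` the (1.66) weight is identically `1` on the punctured zone (the Wilson form);
  `sum_Delta0_curlHat`: the weighted Plancherel `Σ_q Δ₀(q′)|(∂₁A)~_{μν}(q)|² = Σ_{λ,x} |(∂₁A)_{μν}(x+e_λ) − (∂₁A)_{μν}(x)|²`.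
* §3 `oneStepAction_sub_Sphys_le`: `S¹(A) − S⁰(A) ≤ 3γ₀⁻⁶(π⁴/32)·n^{2−d}·½Σ_{μ,ν,λ,x}|∇_λ(∂₁A)_{μν}(x)|²` for EVERY
  η-lattice field `A` (no minimiser yet); §4 **`oneStepConsistency_of_regularity`**: `MinimiserRegularityL2 d C_reg → OneStepConsistency d L
  (3γ₀⁻⁶(π⁴/32)C_reg)`, and **`effAction_rate_of_regularity`**: the rate
  `0 ≤ Δ_{k+1} − Δ_k ≤ 3γ₀⁻⁶(π⁴/32)C_reg·(L⁻²)^k·Δ_k` from L0-REG ALONE.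
-/

noncomputable section

namespace Summit.QuantumFields.BalabanUV.T4Continuum.VariationalPlancherel

open scoped Matrix ComplexConjugate BigOperators
open Summit.QuantumFields.BalabanUV.T4Continuum.VariationalTransfer
open Summit.QuantumFields.BalabanUV.T4Continuum.VariationalLeaves
open Literature.MathematicalPhysics.QuantumFieldTheory.Balaban1983to89
open Literature.MathematicalPhysics.QuantumFieldTheory.Balaban1983to89.B5Prop11Plancherel (Tor fine unitVec sOf dft fdiff
  abs_sOf_le sOf_ne_zero)
open Literature.MathematicalPhysics.QuantumFieldTheory.Balaban1983to89.B5Prop11Fiber (d1Sym norm_d1Sym_sq)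
open Literature.MathematicalPhysics.QuantumFieldTheory.Balaban1983to89.B5Action121 (Fs fdiff_mulVec_apply sdiff_mulVec)
open Literature.MathematicalPhysics.QuantumFieldTheory.Balaban1983to89.B5Block118 (QvOp)
open Literature.MathematicalPhysics.QuantumFieldTheory.Balaban1983to89.B5Hk163Torus (HkOp QvOp_HkOp_mulVec)
open Literature.MathematicalPhysics.QuantumFieldTheory.Balaban1983to89.B5Hk163RDiv (HkOp_minimum)
open Literature.MathematicalPhysics.QuantumFieldTheory.Balaban1983to89.B5Hk164Transl (cEnergy cEnergy_nonneg)
open Literature.MathematicalPhysics.QuantumFieldTheory.Balaban1983to89.B5AverageCurlStokes (plaq plaq_apply)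
open Literature.MathematicalPhysics.QuantumFieldTheory.Balaban1983to89.B4Strip (Delta1r S1r)
open Literature.MathematicalPhysics.QuantumFieldTheory.Balaban1983to89.B5Bounds167Lattice (w166 formDk d1Sq curl curlHat
  hat d1Sq_eq_sum_hat hat_fdiff hat_curl sum_norm_sq_dft curlHat_eq_zero_of)
open Literature.MathematicalPhysics.QuantumFieldTheory.Balaban1983to89.T4GaugeActionRate (xIn gam0 gam0_pos aW sum_aW_eq_one
  w166_eq_sig sig)

variable {d : ℕ} (n L : ℕ) [NeZero n] [NeZero L] (M : Fin d → ℕ) [hM : ∀ μ, NeZero (M μ)]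

/-! ## §1 The three actions in momentum / curl form -/

/-- `Δ_k(B)` (the constrained minimum value in physical units) IS the third expression of (1.66): `effAction n M B = formDk n M B`.
[cite: Balaban1984PropagatorsI, (1.65)–(1.66) p.29] -/
theorem effAction_eq_formDk (B : Tor M × Fin d → ℂ) : effAction n M B = formDk n M B := by
  rw [effAction_eq]
  unfold Sphys cEnergy
  rw [B5Hk163Form166.form_DstarD_HkOp n M B, Complex.ofReal_re]
  have hn : (0 : ℝ) < (n : ℝ) ^ d := by
    have : (0 : ℝ) < n := by exact_mod_cast Nat.pos_of_ne_zero (NeZero.ne n)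
    positivity
  field_simp

omit [NeZero n] in
/-- the plaquette sum of `B5AverageCurlStokes` is the curl of `B5Bounds167Lattice`. [folklore] -/
theorem plaq_eq_curl {N : Fin d → ℕ} [∀ μ, NeZero (N μ)] (A : Tor N × Fin d → ℂ) (μ ν : Fin d) (x : Tor N) :
    plaq N A μ ν x = curl N A μ ν x := by
  rw [plaq_apply]
  unfold curl
  rw [fdiff_mulVec_apply, fdiff_mulVec_apply, sdiff_mulVec, sdiff_mulVec]
  simp only [B5Action121.comp, one_mul]
  ring

/-- the Wilson action in physical units through the unit curl energy: `⟨∂A, ∂A⟩_η = n²·n^{−d}·d1Sq A`. [folklore] -/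
theorem Sphys_eq_d1Sq (A : Tor (fine n M) × Fin d → ℂ) :
    Sphys n M A = (n : ℝ) ^ 2 * ((n : ℝ) ^ d)⁻¹ * d1Sq (fine n M) A := by
  unfold Sphys
  rw [cEnergy_eq_plaq]
  unfold d1Sq
  simp_rw [plaq_eq_curl]
  ring

/-- the ONE-STEP effective action is the fine minimum value: `S¹(A) = Sfine (H^{(1)} A)` with `H^{(1)} = HkOp L (fine n M)`. [folklore] -/
theorem oneStepAction_eq_Sfine (A : Tor (fine n M) × Fin d → ℂ) :
    oneStepAction n L M A = Sfine n L M (HkOp L (fine n M) *ᵥ A) :=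
  blockSpin_eq_of_isMin (Sfine_nonneg n L M) (QvOp_HkOp_mulVec L (fine n M) A) fun A' hA' =>
    mul_le_mul_of_nonneg_left (HkOp_minimum L (fine n M) A A' hA') (by positivity)

/-- the ONE-STEP effective action through (1.66) at block side `L` over the η-lattice as unit lattice:
`S¹(A) = n²·n^{−d}·formDk L (fine n M) A`. [cite: Balaban1984PropagatorsI, (1.66) p.29] -/
theorem oneStepAction_eq (A : Tor (fine n M) × Fin d → ℂ) :
    oneStepAction n L M A = (n : ℝ) ^ 2 * ((n : ℝ) ^ d)⁻¹ * formDk L (fine n M) A := by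
  rw [oneStepAction_eq_Sfine]
  unfold Sfine cEnergy
  rw [B5Hk163Form166.form_DstarD_HkOp L (fine n M) A, Complex.ofReal_re]
  have hn : (0 : ℝ) < (n : ℝ) := by exact_mod_cast Nat.pos_of_ne_zero (NeZero.ne n)
  have hL : (0 : ℝ) < (L : ℝ) := by exact_mod_cast Nat.pos_of_ne_zero (NeZero.ne L)
  rw [mul_pow]
  field_simp

/-! ## §2 The weight at block side one, and the weighted Plancherel -/

omit hM in
/-- at block side `1` (no averaging) the (1.62) inputs are identically `1` on the punctured zone (local copy of the dictionary
leaf `VariationalLeaves.XInOne`, kept here so that this module rests on the landed part of `VariationalLeaves` only). [folklore] -/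
private theorem xIn_one (s : Fin d → ℝ) (hs : ∀ κ, |s κ| ≤ Real.pi) (ν₀ : Fin d) (hν₀ : s ν₀ ≠ 0) (κ : Fin d) :
    xIn 1 s κ = 1 := by
  have hU : ∀ x : ℝ, |x| ≤ Real.pi → B4Strip.uFactorr 1 0 x = 1 := by
    intro x hx
    unfold B4Strip.uFactorr
    rw [if_pos rfl]
    by_cases hx0 : x = 0
    · rw [if_pos hx0]
    · rw [if_neg hx0]
      have hpos : 0 < B4Strip.Sxir 1 x := B4Strip.Sxir_pos 1 le_rfl x hx0 hx
      have hS : B4Strip.Sxir 1 x = B4Strip.S1r x := by unfold B4Strip.Sxir B4Strip.S1r; simp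
      rw [← hS]
      exact div_self hpos.ne'
  have hUr : B4Strip.Ur 1 (fun _ => (0 : Fin 1)) s = 1 := by
    unfold B4Strip.Ur
    exact Finset.prod_eq_one fun μ _ => by simpa using hU (s μ) (hs μ)
  have hD : B4Strip.DeltaXir 1 0 (B4Strip.shiftr 1 (fun _ => (0 : Fin 1)) s) = Delta1r 0 s := by
    rw [B5Prop11Leaves.shiftr_zero]
    unfold B4Strip.DeltaXir Delta1r B4Strip.Sxir B4Strip.S1r
    simp
  have hΔ : 0 < Delta1r 0 s := B5Prop11Leaves.Delta1r_pos s hs ν₀ hν₀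
  have huniv : (Finset.univ : Finset (Fin d → Fin 1)) = {fun _ => 0} :=
    Finset.eq_singleton_iff_unique_mem.2 ⟨Finset.mem_univ _, fun k _ => Subsingleton.elim _ _⟩
  unfold xIn
  rw [B5Bounds167Lattice.phi162_eq 1 le_rfl κ s hs, huniv, Finset.sum_singleton, hUr, hD]
  have hκ : B4Strip.uFactorr 1 ((fun _ => (0 : Fin 1)) κ : ℕ) (s κ) = 1 := by simpa using hU (s κ) (hs κ)
  rw [hκ]
  field_simp

omit hM in
/-- at block side `1` the (1.66) weight is `1` on the punctured zone: `w166 1 μ ν s = 1` (the Wilson form). [folklore] -/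
theorem w166_one_eq_one (μ ν : Fin d) (s : Fin d → ℝ) (hs : ∀ κ, |s κ| ≤ Real.pi) (ν₀ : Fin d) (hν₀ : s ν₀ ≠ 0) :
    w166 1 μ ν s = 1 := by
  rw [w166_eq_sig]
  have hx : ∀ κ, xIn 1 s κ = 1 := fun κ => xIn_one s hs ν₀ hν₀ κ
  have hΔ : Delta1r 0 s ≠ 0 := (B5Prop11Leaves.Delta1r_pos s hs ν₀ hν₀).ne'
  unfold sig
  simp_rw [hx]
  rw [show (∑ κ : Fin d, aW s κ / 1) = 1 by simp_rw [div_one]; exact sum_aW_eq_one s hΔ]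
  norm_num

/-- **weighted Plancherel**: `Σ_q Δ₀(q′)·|(∂₁A)~_{μν}(q)|² = Σ_λ Σ_x |(∂₁A)_{μν}(x + e_λ) − (∂₁A)_{μν}(x)|²` on any torus.
[folklore] -/
theorem sum_Delta0_curlHat {N : Fin d → ℕ} [∀ μ, NeZero (N μ)] (A : Tor N × Fin d → ℂ) (μ ν : Fin d) :
    ∑ q : Tor N, Delta1r 0 (sOf N q) * ‖curlHat N A μ ν q‖ ^ 2
      = ∑ κ : Fin d, ∑ x : Tor N, ‖curl N A μ ν (x + unitVec N κ) - curl N A μ ν x‖ ^ 2 := by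
  -- the scalar field `c = (∂₁A)_{μν}` as a (constant-in-the-component) vector field, to reuse `hat_fdiff`
  set C : Tor N × Fin d → ℂ := fun i => curl N A μ ν i.1 with hC
  have hhat : ∀ q κ', hat N C κ' q = curlHat N A μ ν q := by
    intro q κ'
    unfold hat B5Bounds167Lattice.comp
    exact hat_curl N A μ ν q
  have hside : ∀ κ : Fin d, ∑ x : Tor N, ‖curl N A μ ν (x + unitVec N κ) - curl N A μ ν x‖ ^ 2
      = ∑ q : Tor N, S1r (sOf N q κ) * ‖curlHat N A μ ν q‖ ^ 2 := by
    intro κ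
    have h1 : ∀ x, curl N A μ ν (x + unitVec N κ) - curl N A μ ν x = (fdiff N (1 : ℂ) κ *ᵥ C) (x, κ) := by
      intro x
      rw [fdiff_mulVec_apply, sdiff_mulVec, one_mul]
      simp only [B5Action121.comp, hC]
    simp_rw [h1]
    rw [← sum_norm_sq_dft N (fun x => (fdiff N (1 : ℂ) κ *ᵥ C) (x, κ))]
    refine Finset.sum_congr rfl fun q _ => ?_
    rw [hat_fdiff N C κ κ q, hhat, norm_mul, mul_pow, norm_d1Sym_sq]
  simp_rw [hside]
  rw [Finset.sum_comm]
  refine Finset.sum_congr rfl fun q _ => ?_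
  rw [← Finset.sum_mul]
  congr 1
  unfold Delta1r
  rw [add_zero]

/-! ## §3 The one-step defect for an arbitrary η-lattice field -/

/-- **THE ONE-STEP DEFECT**: for EVERY field `A` on the η-lattice, `S¹(A) − ⟨∂A, ∂A⟩_η ≤ 3γ₀⁻⁶(π⁴/32)·n²n^{−d}·½Σ_{μ,ν,λ,x}
|(∂₁A)_{μν}(x+e_λ) − (∂₁A)_{μν}(x)|²` (L0-ONE through the Plancherel dictionary; valid for every block side `L ≥ 1`). [folklore] -/
theorem oneStepAction_sub_Sphys_le (hL : 1 ≤ L) (A : Tor (fine n M) × Fin d → ℂ) :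
    oneStepAction n L M A - Sphys n M A
      ≤ 3 / gam0 d ^ 6 * (Real.pi ^ 4 / 32) * ((n : ℝ) ^ 2 * ((n : ℝ) ^ d)⁻¹ *
          (1 / 2 * ∑ μ : Fin d, ∑ ν : Fin d, ∑ κ : Fin d, ∑ x : Tor (fine n M),
            ‖curl (fine n M) A μ ν (x + unitVec (fine n M) κ) - curl (fine n M) A μ ν x‖ ^ 2)) := by
  rw [oneStepAction_eq, Sphys_eq_d1Sq, d1Sq_eq_sum_hat, ← mul_sub]
  unfold formDk
  rw [← mul_sub, ← Finset.sum_sub_distrib]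
  have hK : 0 ≤ 3 / gam0 d ^ 6 * (Real.pi ^ 4 / 32) := by
    have := gam0_pos d; positivity
  have hnd : 0 ≤ (n : ℝ) ^ 2 * ((n : ℝ) ^ d)⁻¹ := by positivity
  -- per (μ, ν): Σ_q (w_L − 1)|ĉ|² ≤ K Σ_q Δ₀|ĉ|² = K Σ_{κ,x} |∇_κ c|²
  have key : ∀ μ ν : Fin d,
      ∑ q, (w166 L μ ν (sOf (fine n M) q) * ‖curlHat (fine n M) A μ ν q‖ ^ 2 - ‖curlHat (fine n M) A μ ν q‖ ^ 2)
      ≤ 3 / gam0 d ^ 6 * (Real.pi ^ 4 / 32) *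
          ∑ κ, ∑ x, ‖curl (fine n M) A μ ν (x + unitVec (fine n M) κ) - curl (fine n M) A μ ν x‖ ^ 2 := by
    intro μ ν
    rw [← sum_Delta0_curlHat, Finset.mul_sum]
    refine Finset.sum_le_sum fun q _ => ?_
    by_cases hq : sOf (fine n M) q = 0
    · rw [curlHat_eq_zero_of (fine n M) A μ ν q hq]
      simp
    · obtain ⟨ν₀, hν₀⟩ : ∃ ν₀, sOf (fine n M) q ν₀ ≠ 0 := Function.ne_iff.mp hq
      have hs : ∀ κ, |sOf (fine n M) q κ| ≤ Real.pi := abs_sOf_le (fine n M) q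
      have hw := VariationalOneStepSymbol.w166_sub_w166_le_Delta0 L 1 hL le_rfl μ ν (sOf (fine n M) q) hs ν₀ hν₀
      rw [w166_one_eq_one μ ν _ hs ν₀ hν₀] at hw
      have hw' : w166 L μ ν (sOf (fine n M) q) - 1 ≤ 3 / gam0 d ^ 6 * (Real.pi ^ 4 / 32 * Delta1r 0 (sOf (fine n M) q)) :=
        (le_abs_self _).trans hw
      have hc : 0 ≤ ‖curlHat (fine n M) A μ ν q‖ ^ 2 := by positivity
      calc w166 L μ ν (sOf (fine n M) q) * ‖curlHat (fine n M) A μ ν q‖ ^ 2 - ‖curlHat (fine n M) A μ ν q‖ ^ 2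
          = (w166 L μ ν (sOf (fine n M) q) - 1) * ‖curlHat (fine n M) A μ ν q‖ ^ 2 := by ring
        _ ≤ (3 / gam0 d ^ 6 * (Real.pi ^ 4 / 32 * Delta1r 0 (sOf (fine n M) q))) * ‖curlHat (fine n M) A μ ν q‖ ^ 2 :=
            mul_le_mul_of_nonneg_right hw' hc
        _ = 3 / gam0 d ^ 6 * (Real.pi ^ 4 / 32) * (Delta1r 0 (sOf (fine n M) q) * ‖curlHat (fine n M) A μ ν q‖ ^ 2) := by
            ring
  have hsum : ∑ μ, ∑ ν, ∑ q,
        (w166 L μ ν (sOf (fine n M) q) * ‖curlHat (fine n M) A μ ν q‖ ^ 2 - ‖curlHat (fine n M) A μ ν q‖ ^ 2)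
      ≤ 3 / gam0 d ^ 6 * (Real.pi ^ 4 / 32) *
          ∑ μ, ∑ ν, ∑ κ, ∑ x, ‖curl (fine n M) A μ ν (x + unitVec (fine n M) κ) - curl (fine n M) A μ ν x‖ ^ 2 := by
    rw [Finset.mul_sum]
    refine Finset.sum_le_sum fun μ _ => ?_
    rw [Finset.mul_sum]
    exact Finset.sum_le_sum fun ν _ => key μ ν
  simp_rw [← Finset.sum_sub_distrib]
  have h2 := mul_le_mul_of_nonneg_left (mul_le_mul_of_nonneg_left hsum (by norm_num : (0:ℝ) ≤ 1 / 2)) hnd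
  exact h2.trans_eq (by ring)

/-! ## §4 The tier-0 assembly: regularity of the minimiser ⟹ one-step consistency ⟹ the rate -/

omit [NeZero n] [NeZero L] hM in
/-- reorder a fourfold sum: `Σ_a Σ_b Σ_c Σ_e = Σ_b Σ_c Σ_e Σ_a`. [folklore] -/
theorem sum4_comm {α β γ δ : Type*} [Fintype α] [Fintype β] [Fintype γ] [Fintype δ] (f : α → β → γ → δ → ℝ) :
    ∑ a, ∑ b, ∑ c, ∑ e, f a b c e = ∑ b, ∑ c, ∑ e, ∑ a, f a b c e := by
  calc ∑ a, ∑ b, ∑ c, ∑ e, f a b c e = ∑ b, ∑ a, ∑ c, ∑ e, f a b c e := Finset.sum_comm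
    _ = ∑ b, ∑ c, ∑ a, ∑ e, f a b c e := Finset.sum_congr rfl fun b _ => Finset.sum_comm
    _ = ∑ b, ∑ c, ∑ e, ∑ a, f a b c e :=
        Finset.sum_congr rfl fun b _ => Finset.sum_congr rfl fun c _ => Finset.sum_comm

omit [NeZero n] [NeZero L] hM in
/-- reorder a threefold sum: `Σ_a Σ_b Σ_c = Σ_b Σ_c Σ_a`. [folklore] -/
theorem sum3_comm {α β γ : Type*} [Fintype α] [Fintype β] [Fintype γ] (f : α → β → γ → ℝ) :
    ∑ a, ∑ b, ∑ c, f a b c = ∑ b, ∑ c, ∑ a, f a b c := by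
  calc ∑ a, ∑ b, ∑ c, f a b c = ∑ b, ∑ a, ∑ c, f a b c := Finset.sum_comm
    _ = ∑ b, ∑ c, ∑ a, f a b c := Finset.sum_congr rfl fun b _ => Finset.sum_comm

/-- the curvature `F^{(η)} = n·(∂₁A)` (B5's lattice factor `η⁻¹ = n`). [folklore] -/
theorem Fs_eq_mul_curl (A : Tor (fine n M) × Fin d → ℂ) (μ ν : Fin d) (y : Tor (fine n M)) :
    Fs (fine n M) (n : ℂ) A μ ν y = (n : ℂ) * curl (fine n M) A μ ν y := by
  rw [B5AverageCurlStokes.Fs_eq_mul_plaq, plaq_eq_curl]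

/-- **TIER-0 ASSEMBLY, STEP 1: L0-REG ⟹ L0-CONS.**  The L²-regularity of Bałaban's minimiser (`MinimiserRegularityL2 d C_reg`, the
one remaining typed leaf) implies the one-step consistency on the minimiser for EVERY block side `L ≥ 1`:
`OneStepConsistency d L (3γ₀⁻⁶(π⁴/32)·C_reg)`. [folklore] -/
theorem oneStepConsistency_of_regularity {Creg : ℝ} (hreg : MinimiserRegularityL2 d Creg) (hL : 1 ≤ L) :
    OneStepConsistency d L (3 / gam0 d ^ 6 * (Real.pi ^ 4 / 32) * Creg) := by
  intro n _ M _ B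
  set A := HkOp n M *ᵥ B with hA
  have hn : (0 : ℝ) < (n : ℝ) := by exact_mod_cast Nat.pos_of_ne_zero (NeZero.ne n)
  have hn2 : (0 : ℝ) < (n : ℝ) ^ 2 := by positivity
  have hK : 0 ≤ 3 / gam0 d ^ 6 * (Real.pi ^ 4 / 32) := by have := gam0_pos d; positivity
  -- the defect bound for `A = H_kB`
  have hdef := oneStepAction_sub_Sphys_le n L M hL A
  -- the regularity hypothesis, rewritten through `F = n·curl`
  have hR := hreg n M B
  simp_rw [← hA, Fs_eq_mul_curl, ← mul_sub, norm_mul, Complex.norm_natCast, mul_pow, ← Finset.mul_sum] at hR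
  -- hR : n² · Σ_x Σ_μ Σ_ν Σ_κ |∇curl|² ≤ Creg / n² · (n² · Σ_x Σ_μ Σ_ν |curl|²)
  set G : ℝ := ∑ μ : Fin d, ∑ ν : Fin d, ∑ κ : Fin d, ∑ x : Tor (fine n M),
      ‖curl (fine n M) A μ ν (x + unitVec (fine n M) κ) - curl (fine n M) A μ ν x‖ ^ 2 with hG
  have hG' : (∑ x : Tor (fine n M), ∑ μ : Fin d, ∑ ν : Fin d, ∑ κ : Fin d,
      ‖curl (fine n M) A μ ν (x + unitVec (fine n M) κ) - curl (fine n M) A μ ν x‖ ^ 2) = G := by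
    rw [hG]; exact sum4_comm _
  have hE : (∑ x : Tor (fine n M), ∑ μ : Fin d, ∑ ν : Fin d, ‖curl (fine n M) A μ ν x‖ ^ 2)
      = 2 * d1Sq (fine n M) A := by
    unfold d1Sq; rw [sum3_comm]; ring
  rw [hG', hE] at hR
  -- G ≤ Creg/n² · 2 d1Sq
  have hGle : G ≤ Creg / (n : ℝ) ^ 2 * (2 * d1Sq (fine n M) A) := by
    have := hR
    rw [show Creg / (n : ℝ) ^ 2 * ((n : ℝ) ^ 2 * (2 * d1Sq (fine n M) A))
        = (n : ℝ) ^ 2 * (Creg / (n : ℝ) ^ 2 * (2 * d1Sq (fine n M) A)) by ring] at this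
    exact le_of_mul_le_mul_left this hn2
  have hS : Sphys n M A = (n : ℝ) ^ 2 * ((n : ℝ) ^ d)⁻¹ * d1Sq (fine n M) A := Sphys_eq_d1Sq n M A
  have hnd : 0 ≤ (n : ℝ) ^ 2 * ((n : ℝ) ^ d)⁻¹ := by positivity
  -- assemble
  have h1 : oneStepAction n L M A - Sphys n M A
      ≤ 3 / gam0 d ^ 6 * (Real.pi ^ 4 / 32) * ((n : ℝ) ^ 2 * ((n : ℝ) ^ d)⁻¹ *
          (1 / 2 * (Creg / (n : ℝ) ^ 2 * (2 * d1Sq (fine n M) A)))) :=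
    hdef.trans (by gcongr)
  rw [hS]
  have h2 : 3 / gam0 d ^ 6 * (Real.pi ^ 4 / 32) * ((n : ℝ) ^ 2 * ((n : ℝ) ^ d)⁻¹ *
        (1 / 2 * (Creg / (n : ℝ) ^ 2 * (2 * d1Sq (fine n M) A))))
      = 3 / gam0 d ^ 6 * (Real.pi ^ 4 / 32) * Creg / (n : ℝ) ^ 2 *
          ((n : ℝ) ^ 2 * ((n : ℝ) ^ d)⁻¹ * d1Sq (fine n M) A) := by
    field_simp
  rw [h2, ← hS] at h1
  rw [← hS]
  have : (1 + 3 / gam0 d ^ 6 * (Real.pi ^ 4 / 32) * Creg / (n : ℝ) ^ 2) * Sphys n M A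
      = Sphys n M A + 3 / gam0 d ^ 6 * (Real.pi ^ 4 / 32) * Creg / (n : ℝ) ^ 2 * Sphys n M A := by ring
  rw [this]
  linarith

/-- **TIER-0 ASSEMBLY, STEP 2: L0-REG ⟹ THE RATE.**  From the L²-regularity of the minimiser ALONE (the one open leaf), the
form-level η-rate of Bałaban's `U = 1` effective action at every level, every torus, every `B`, in King's shape:
`0 ≤ Δ_{k+1}(B) − Δ_k(B) ≤ 3γ₀⁻⁶(π⁴/32)C_reg·(L⁻²)^k·Δ_k(B)`. [folklore] -/
theorem effAction_rate_of_regularity {Creg : ℝ} (hreg : MinimiserRegularityL2 d Creg) (hL : 1 ≤ L) (k : ℕ)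
    (B : Tor M × Fin d → ℂ) :
    haveI : NeZero (L ^ k) := ⟨pow_ne_zero k (NeZero.ne L)⟩
    0 ≤ effActionSucc (L ^ k) L M B - effAction (L ^ k) M B ∧
      effActionSucc (L ^ k) L M B - effAction (L ^ k) M B
        ≤ 3 / gam0 d ^ 6 * (Real.pi ^ 4 / 32) * Creg * (((L : ℝ) ^ 2)⁻¹) ^ k * effAction (L ^ k) M B :=
  effAction_rate_king (oneStepConsistency_of_regularity L hreg hL) k M B

end Summit.QuantumFields.BalabanUV.T4Continuum.VariationalPlancherel
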